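import Literature.AlgebraicGeometry.Resolution.BlowupAlgebraRelations
import Literature.AlgebraicGeometry.Resolution.BlowupAlgebraStrictTransform
import HarnessLib

/-!
# The obvious relations generate the ideal of the affine blowup algebra (Stacks 0BIQ, quasi-regular Noetherian case)

Topic: `Literature/AlgebraicGeometry/Resolution`. Continuation of `BlowupAlgebraPresentation.lean`
(the evaluation presentation `eval : R[T_j : j ≠ i] ↠ R[I/xᵢ]`, `T_j ↦ x_j/xᵢ`, of the affine
blowup algebra of `I = (x₁, …, x_r)`; for `x` quasi-regular the relations modulo `xᵢ` are
`I · R[T]`, `eval_mem_span_algebraMap_iff'`) and `BlowupAlgebraRelations.lean` (the obvious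
relations `rel x i j = x_j - xᵢ T_j` lie in the kernel and cut out the blowup algebra
SET-theoretically for `x` quasi-regular, `zeroLocus_ker_eval`).

Here the SCHEME-theoretic statement (The Stacks Project, Tag 0BIQ, Lemma: "If `a, a₂, …, a_n`
is an `H₁`-regular sequence then the blowup algebra `R[I/a]` is `R[y₂, …, y_n]/(a y_j - a_j)`"),
in the form available in the tree: for a **Noetherian** ring `R` and a **quasi-regular**
sequence `x` (Matsumura §16; every `R`-sequence is quasi-regular, `isQuasiRegular_of_isWeaklyRegular`),

  `ker (eval : R[T_j : j ≠ i] → R[I/xᵢ]) = (x_j - xᵢ T_j : j ≠ i)`  (`ker_eval_eq_span_rel`),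

whence the presentation `R[T_j : j ≠ i]/(x_j - xᵢ T_j) ≅ R[I/xᵢ]` (`quotientSpanRelEquiv`): the
chart over `xᵢ` of the blow-up of `Spec R` along `V(x₁, …, x_r)` is the closed subscheme of
`𝔸^{r-1}_R` cut out by the `r - 1` equations `xᵢ T_j = x_j`, as a SCHEME. The proof is
elementary (no Koszul complexes): with `K = ker eval` and `L = (x_j - xᵢ T_j)`,
(1) `K` is `xᵢ`-saturated (`xᵢ` is a non-zero-divisor of `R[I/xᵢ] ⊆ R[1/xᵢ]`);
(2) `K ⊆ L + xᵢ K` — by quasi-regularity `K ⊆ I·R[T] ⊆ L + (xᵢ)`, and (1);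
(3) `K` is `xᵢ`-power torsion modulo `L`: for `k ∈ K` of total degree `d`, `xᵢ^d k ≡ c (mod L)`
for a constant `c ∈ R` with `c/xᵢ^d = k(x_j/xᵢ) = 0` in `R[1/xᵢ]`, so `xᵢ^e c = 0`;
(4) `R` Noetherian makes `K` finitely generated, so `xᵢ^N K ⊆ L` for one `N`, and iterating (2),
`K ⊆ L + xᵢ^N K ⊆ L`. Everything is PROVED; no named facts.

* `blowupAlgebra.mem_ker_eval_of_C_mul_mem` — (1);
* `blowupAlgebra.ker_eval_le_span_rel_sup` — (2);
* `blowupAlgebra.exists_pow_C_mul_mem_span_rel` — (3) (any ring, any sequence);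
* `blowupAlgebra.ker_eval_eq_span_rel` — **the theorem**; `blowupAlgebra.quotientSpanRelEquiv`,
  `quotientSpanRelEquiv_mk` — **the presentation `R[T_j : j ≠ i]/(x_j - xᵢ T_j) ≃ₐ[R] R[I/xᵢ]`**;
  `blowupAlgebra.ker_eval_eq_span_rel_of_isWeaklyRegular` — the case of an `R`-sequence.

## Sources

* The Stacks Project, Tag 0BIQ (blowup algebra of an `H₁`-regular sequence), Tag 052P
  (affine blowup algebras). [StacksProject]
* H. Matsumura, *Commutative Ring Theory*, CUP 1986, §16 Thm. 16.2 (quasi-regular sequences).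
  [Matsumura1987]
* U. Görtz, T. Wedhorn, *Algebraic Geometry I*, 2nd ed. (2020), (13.19) p. 415, Example 13.95.
  [GortzWedhorn2020]
-/

noncomputable section

open MvPolynomial

universe u

namespace Literature.AlgebraicGeometry.Resolution

namespace blowupAlgebra

variable {R : Type u} [CommRing R] {r : ℕ} (x : Fin r → R) (i : Fin r)

local notation3 "P" => MvPolynomial {j : Fin r // j ≠ i} R
local notation3 "B" => blowupAlgebra (Ideal.span (Set.range x)) (x i)
local notation3 "K" => RingHom.ker (eval x i).toRingHom
local notation3 "L" => Ideal.span (Set.range (rel x i))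

/-! ### (1) The kernel is `xᵢ`-saturated -/

/-- `xᵢ · g ∈ ker eval → g ∈ ker eval`: `xᵢ` is a non-zero-divisor of `R[I/xᵢ] ⊆ R[1/xᵢ]`.
[cite: StacksProject, Tag 052P] -/
theorem mem_ker_eval_of_C_mul_mem {g : P} (h : C (x i) * g ∈ K) : g ∈ K := by
  rw [RingHom.mem_ker] at h ⊢
  rw [AlgHom.toRingHom_eq_coe, RingHom.coe_coe] at h ⊢
  rw [map_mul, eval_C] at h
  exact blowupAlgebra.eq_zero_of_pow_mul_eq_zero (Ideal.span (Set.range x)) (x i) (N := 1)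
    (by rwa [pow_one])

/-- Power version: `xᵢⁿ · g ∈ ker eval → g ∈ ker eval`. [cite: StacksProject, Tag 052P] -/
theorem mem_ker_eval_of_C_pow_mul_mem {g : P} {n : ℕ} (h : C (x i) ^ n * g ∈ K) : g ∈ K := by
  induction n with
  | zero => rwa [pow_zero, one_mul] at h
  | succ n ih =>
    apply ih
    apply mem_ker_eval_of_C_mul_mem
    rwa [← mul_assoc, ← pow_succ']

/-- The obvious relations lie in the kernel: `L ≤ K`. [cite: StacksProject, Tag 052P] -/
theorem span_rel_le_ker : L ≤ K := by
  rw [Ideal.span_le]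
  exact range_rel_subset_ker x i

/-! ### (2) `K ⊆ L + xᵢ K` for `x` quasi-regular -/

/-- `I · R[T] ⊆ L + (xᵢ)`: `x_j = (x_j - xᵢ T_j) + xᵢ T_j`. [folklore] -/
theorem map_C_span_le_span_rel_sup :
    Ideal.map (C : R →+* P) (Ideal.span (Set.range x)) ≤ L ⊔ Ideal.span {C (x i)} := by
  rw [Ideal.map_span, Ideal.span_le]
  rintro _ ⟨_, ⟨j, rfl⟩, rfl⟩
  by_cases hj : j = i
  · subst hj
    exact Ideal.mem_sup_right (Ideal.subset_span rfl)
  · have hrel : rel x i ⟨j, hj⟩ ∈ L := Ideal.subset_span ⟨⟨j, hj⟩, rfl⟩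
    have : (C (x j) : P) = rel x i ⟨j, hj⟩ + C (x i) * X ⟨j, hj⟩ := by
      rw [rel]; ring
    rw [SetLike.mem_coe, this]
    exact Ideal.add_mem _ (Ideal.mem_sup_left hrel)
      (Ideal.mem_sup_right (Ideal.mul_mem_right _ _ (Ideal.subset_span rfl)))

/-- **`K ⊆ L + xᵢ · K`** for `x` quasi-regular: an element of the kernel maps to `0 ∈ (xᵢ)`, so
lies in `I · R[T] ⊆ L + (xᵢ)` (`eval_mem_span_algebraMap_iff'`, Stacks 0BIQ), and the cofactor
of `xᵢ` is again in the kernel by (1). [cite: StacksProject, Tag 0BIQ] -/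
theorem ker_eval_le_span_rel_sup (hx : IsQuasiRegular x) :
    K ≤ L ⊔ Ideal.span {C (x i)} * K := by
  intro k hk
  have hk0 : eval x i k = 0 := by
    have h := hk
    rwa [RingHom.mem_ker, AlgHom.toRingHom_eq_coe, RingHom.coe_coe] at h
  have hmem : k ∈ Ideal.map (C : R →+* P) (Ideal.span (Set.range x)) := by
    rw [← eval_mem_span_algebraMap_iff' x i hx, hk0]
    exact Ideal.zero_mem _
  obtain ⟨l, hl, d, hd, hsum⟩ := Submodule.mem_sup.mp (map_C_span_le_span_rel_sup x i hmem)
  obtain ⟨g, rfl⟩ := Ideal.mem_span_singleton'.mp hd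
  have hgK : C (x i) * g ∈ K := by
    have : g * C (x i) = k - l := by rw [← hsum]; ring
    rw [mul_comm, this]
    exact Ideal.sub_mem _ hk (span_rel_le_ker x i hl)
  have hg : g ∈ K := mem_ker_eval_of_C_mul_mem x i hgK
  rw [← hsum]
  exact Ideal.add_mem _ (Ideal.mem_sup_left hl)
    (Ideal.mem_sup_right (by rw [mul_comm g (C (x i))]; exact Ideal.mul_mem_mul (Ideal.subset_span rfl) hg))

/-- Iterating: `K ⊆ L + xᵢⁿ · K` for every `n`. [cite: StacksProject, Tag 0BIQ] -/
theorem ker_eval_le_span_rel_sup_pow (hx : IsQuasiRegular x) (n : ℕ) :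
    K ≤ L ⊔ Ideal.span {C (x i) ^ n} * K := by
  induction n with
  | zero =>
    rw [pow_zero, Ideal.span_singleton_one, Ideal.top_mul]
    exact le_sup_right
  | succ n ih =>
    calc K ≤ L ⊔ Ideal.span {C (x i)} * K := ker_eval_le_span_rel_sup x i hx
      _ ≤ L ⊔ Ideal.span {C (x i)} * (L ⊔ Ideal.span {C (x i) ^ n} * K) :=
          sup_le_sup_left (Ideal.mul_mono_right ih) _
      _ ≤ L ⊔ Ideal.span {C (x i) ^ (n + 1)} * K := by
          rw [Ideal.mul_sup, ← mul_assoc, Ideal.span_singleton_mul_span_singleton, ← pow_succ']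
          refine sup_le le_sup_left (sup_le ?_ le_sup_right)
          exact le_sup_of_le_left Ideal.mul_le_left

/-! ### (3) The kernel is `xᵢ`-power torsion modulo the relations -/

/-- `aeval` into constants: `k(C ∘ g) = C(k(g))`. [folklore] -/
theorem aeval_C_comp {τ : Type*} (g : τ → R) (k : MvPolynomial τ R) :
    aeval (fun t => (C (g t) : MvPolynomial τ R)) k = C (MvPolynomial.eval g k) := by
  induction k using MvPolynomial.induction_on with
  | C a => rw [algHom_C, MvPolynomial.algebraMap_eq, MvPolynomial.eval_C]
  | add p q hp hq => rw [map_add, map_add, map_add, hp, hq]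
  | mul_X p t hp => rw [map_mul, map_mul, map_mul, hp, aeval_X, MvPolynomial.eval_X]

/-- The rescaling `T_j ↦ xᵢ T_j` agrees with the evaluation `T_j ↦ x_j` modulo the relations.
[folklore] -/
theorem mkₐ_comp_aeval_C_mul_X_eq :
    (Ideal.Quotient.mkₐ R L).comp (aeval fun j : {j : Fin r // j ≠ i} => (C (x i) * X j : P)) =
      (Ideal.Quotient.mkₐ R L).comp (aeval fun j : {j : Fin r // j ≠ i} => (C (x j.1) : P)) := by
  refine MvPolynomial.algHom_ext fun j => ?_
  simp only [AlgHom.comp_apply, aeval_X, Ideal.Quotient.mkₐ_eq_mk]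
  rw [Ideal.Quotient.eq]
  have : (C (x i) * X j - C (x j.1) : P) = -rel x i j := by rw [rel]; ring
  rw [this]
  exact Submodule.neg_mem _ (Ideal.subset_span ⟨j, rfl⟩)

/-- The rescaling on a monomial: `(xᵢ T)^α = xᵢ^{|α|} T^α`. [folklore] -/
theorem aeval_C_mul_X_monomial (α : {j : Fin r // j ≠ i} →₀ ℕ) (c : R) :
    aeval (fun j : {j : Fin r // j ≠ i} => (C (x i) * X j : P)) (monomial α c) =
      C (x i) ^ (α.sum fun _ e => e) * monomial α c := by
  rw [aeval_monomial, Finsupp.prod, Finsupp.sum]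
  simp_rw [mul_pow]
  rw [Finset.prod_mul_distrib, Finset.prod_pow_eq_pow_sum, prod_X_pow_eq_monomial,
    MvPolynomial.algebraMap_eq, mul_left_comm, C_mul_monomial, mul_one]

/-- **`xᵢ^d · k ≡ c (mod L)` for a constant `c`**, `d` the total degree of `k`: clear the
denominators of `k(x_j/xᵢ)` using `xᵢ T_j ≡ x_j`. [cite: StacksProject, Tag 0BIQ] -/
theorem exists_C_pow_mul_sub_C_mem_span_rel (k : P) :
    ∃ c : R, C (x i) ^ k.totalDegree * k - C c ∈ L := by
  classical
  -- `k' = Σ_α coeff_α xᵢ^{d - |α|} T^α`, so that the rescaling of `k'` is `xᵢ^d k`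
  set d := k.totalDegree
  let k' : P := ∑ α ∈ k.support, monomial α (coeff α k * x i ^ (d - α.sum fun _ e => e))
  have hθ : aeval (fun j : {j : Fin r // j ≠ i} => (C (x i) * X j : P)) k' = C (x i) ^ d * k := by
    rw [map_sum]
    conv_rhs => rw [← support_sum_monomial_coeff k, Finset.mul_sum]
    refine Finset.sum_congr rfl fun α hα => ?_
    rw [aeval_C_mul_X_monomial, mul_comm (coeff α k) (x i ^ _), ← C_mul_monomial, C_pow,
      ← mul_assoc, ← pow_add, Nat.add_sub_cancel' (le_totalDegree hα)]
  refine ⟨MvPolynomial.eval (fun j : {j : Fin r // j ≠ i} => x j.1) k', ?_⟩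
  rw [← Ideal.Quotient.eq, ← Ideal.Quotient.mkₐ_eq_mk R, ← hθ, ← aeval_C_comp, ← AlgHom.comp_apply,
    mkₐ_comp_aeval_C_mul_X_eq, AlgHom.comp_apply]

/-- **The kernel is `xᵢ`-power torsion modulo the obvious relations**: for `k ∈ ker eval` there
is `n` with `xᵢⁿ k ∈ (x_j - xᵢ T_j : j ≠ i)` (any ring, any sequence: over `D(xᵢ)` the relations
already present `R[1/xᵢ]`). [cite: StacksProject, Tag 0BIQ] -/
theorem exists_pow_C_mul_mem_span_rel {k : P} (hk : k ∈ K) : ∃ n : ℕ, C (x i) ^ n * k ∈ L := by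
  obtain ⟨c, hc⟩ := exists_C_pow_mul_sub_C_mem_span_rel x i k
  -- `C c ∈ K`, so `c/1 = 0` in `R[1/xᵢ]`, so `xᵢ^e c = 0`
  have hcK : (C c : P) ∈ K := by
    have h1 : C (x i) ^ k.totalDegree * k ∈ K := Ideal.mul_mem_left _ _ hk
    have h2 := Ideal.sub_mem _ h1 (span_rel_le_ker x i hc)
    rwa [sub_sub_cancel] at h2
  have hc0 : algebraMap R (Localization.Away (x i)) c = 0 := by
    rw [RingHom.mem_ker, AlgHom.toRingHom_eq_coe, RingHom.coe_coe, eval_C] at hcK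
    have := congrArg Subtype.val hcK
    simpa using this
  obtain ⟨⟨_, e, rfl⟩, he⟩ := (IsLocalization.map_eq_zero_iff (Submonoid.powers (x i)) _ _).mp hc0
  refine ⟨e + k.totalDegree, ?_⟩
  have : C (x i) ^ (e + k.totalDegree) * k =
      C (x i) ^ e * (C (x i) ^ k.totalDegree * k - C c) + C (x i ^ e * c) := by
    rw [map_mul, C_pow]; ring
  rw [this, he, C_0, add_zero]
  exact Ideal.mul_mem_left _ _ hc

/-! ### (4) The theorem -/

/-- **Stacks 0BIQ (quasi-regular Noetherian form): the obvious relations generate the ideal of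
the affine blowup algebra**, `ker (T_j ↦ x_j/xᵢ) = (x_j - xᵢ T_j : j ≠ i)`, for `R` Noetherian
and `x` quasi-regular. [cite: StacksProject, Tag 0BIQ] [cite: Matsumura1987, §16 Thm. 16.2] -/
theorem ker_eval_eq_span_rel [IsNoetherianRing R] (hx : IsQuasiRegular x) : K = L := by
  classical
  refine le_antisymm ?_ (span_rel_le_ker x i)
  -- `K` is finitely generated; one power of `xᵢ` kills all generators modulo `L`
  haveI : IsNoetherianRing P := MvPolynomial.isNoetherianRing
  obtain ⟨G, hG⟩ := (isNoetherian_def.mp (inferInstance : IsNoetherian P P)) K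
  have hgen : ∀ g ∈ G, ∃ n : ℕ, C (x i) ^ n * g ∈ L := fun g hg =>
    exists_pow_C_mul_mem_span_rel x i (hG ▸ Ideal.subset_span hg)
  choose! n hn using hgen
  have hN : ∀ k ∈ K, C (x i) ^ G.sup n * k ∈ L := by
    intro k hk
    rw [← hG] at hk
    refine Submodule.span_induction ?_ ?_ ?_ ?_ hk
    · intro g hg
      obtain ⟨m, hm⟩ := Nat.exists_eq_add_of_le (Finset.le_sup (f := n) hg)
      rw [hm, pow_add, mul_comm (C (x i) ^ n g), mul_assoc]
      exact Ideal.mul_mem_left _ _ (hn g hg)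
    · rw [mul_zero]; exact Ideal.zero_mem _
    · intro a b _ _ ha hb
      rw [mul_add]; exact Ideal.add_mem _ ha hb
    · intro c a _ ha
      rw [smul_eq_mul, mul_left_comm]
      exact Ideal.mul_mem_left _ _ ha
  -- `K ⊆ L + xᵢ^N K ⊆ L`
  refine (ker_eval_le_span_rel_sup_pow x i hx (G.sup n)).trans (sup_le le_rfl ?_)
  rw [Ideal.mul_le]
  intro a ha k hk
  obtain ⟨b, rfl⟩ := Ideal.mem_span_singleton'.mp ha
  rw [mul_assoc]
  exact Ideal.mul_mem_left _ _ (hN k hk)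

/-- The case of an `R`-sequence (`R`-sequences are quasi-regular, Matsumura Thm. 16.2 / Rees).
[cite: StacksProject, Tag 0BIQ] [cite: Matsumura1987, §16 Thm. 16.2] -/
theorem ker_eval_eq_span_rel_of_isWeaklyRegular [IsNoetherianRing R]
    (hx : RingTheory.Sequence.IsWeaklyRegular R (List.ofFn x)) : K = L :=
  ker_eval_eq_span_rel x i (isQuasiRegular_of_isWeaklyRegular x hx)

/-- **The presentation `R[T_j : j ≠ i]/(x_j - xᵢ T_j) ≃ₐ[R] R[I/xᵢ]`** of the affine blowup algebra
of a quasi-regular sequence over a Noetherian ring: the chart over `xᵢ` of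
`Bl_{V(x₁,…,x_r)} Spec R` is the closed subscheme `{xᵢ T_j = x_j}` of `𝔸^{r-1}_R`, as a scheme.
[cite: StacksProject, Tag 0BIQ] -/
def quotientSpanRelEquiv [IsNoetherianRing R] (hx : IsQuasiRegular x) : (P ⧸ L) ≃ₐ[R] B :=
  (Ideal.quotientEquivAlgOfEq R (ker_eval_eq_span_rel x i hx).symm).trans
    (Ideal.quotientKerAlgEquivOfSurjective (eval_surjective x i))

/-- The presentation on classes: `[h] ↦ h(x_j/xᵢ)`. [folklore] -/
@[simp]
theorem quotientSpanRelEquiv_mk [IsNoetherianRing R] (hx : IsQuasiRegular x) (h : P) :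
    quotientSpanRelEquiv x i hx (Ideal.Quotient.mk _ h) = eval x i h :=
  rfl

end blowupAlgebra

end Literature.AlgebraicGeometry.Resolution

end
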